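import Summits.AtomisticToContinuum.Crystallization.Theorems.ChartedZeroExcessLayeredLatticeLiouvilleZC

/-!
# (B′.6d) W1 pieces ZZZD — THE TWO-RADIUS EDITIONS OF THE SIX ZB/ZC PIECES (statement file: 6 `def … : Prop`, no theorem)

Lineage `stmt-AtomisticToContinuum-26636` (route ChartedPlanarOrder), lens-2 g81, FINDING «IC» (critic row 1508) option **W1-β**, memo «W1-CONSUMERS»
(HOME `decomp-a2c-lens-2/g81/memo/W1-CONSUMERS.md`).  The registration transport RF/RFC (tree ZZZA/ZZZB, rider ZZZC `slabIso_package_reg`) delivers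
X_Θ's partnered-collar clause only from the Θ-radius `rΘ = 145/16 = r + 17/16`, not from the cool radius `r = 8`.  W1 keeps every INPUT at `r`
(cool-zone tameness `IsTameOn ϑc … (moatIn S K r (r + rsh))`, REG-out/REG-in of `IsCoolShadowCrystal σ ϑr Rs ε r rI ℓ`) and reads the LABEL's collar
clause (iv) (`dist p (lab p) ≤ ε` for `rΘ < d(p, K)`) from `rΘ`; anchors are re-centred on the moat `(rΘ, r + rsh)` (`IsAnchorAtom rΘ (r + rsh − rΘ) ℓ`,
the original picture translated outward by `17/16`, lever of (AR) unchanged) and (LN)'s domain grows to `coreOf S K rΘ`.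

Pieces (binder telescopes of ZB `SingleVariantP` / `AnchorRegistrationP` / `LabelledNetP` / `LabelCoveringP` and ZC `BondLabelP` / `BondCoherenceP`
VERBATIM, one extra dial `rΘ` after `r`): `SingleVariantP₂`, `AnchorRegistrationP₂`, `LabelledNetP₂`, `LabelCoveringP₂`, `BondLabelP₂`,
`BondCoherenceP₂`.  Their mechanisms, why-might-fail and sources are those of the originals (ZBA/ZB/ZC module docstrings); the ONLY consumer of clause
(iv) at a radius, ZB `coreOccupancyP_of_variantLabel` (split `r < d(p,K)`), moves its split to `rΘ` — proved in the sequel ZZZE together with every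
junction of record and (GL₂)'s Θ-junction at `rΘ` (tree ZZP instantiated).  The originals stay in the tree unharmed (they are not literally the case
`rΘ = r`: `IsAnchorAtom r (r + rsh − r)` vs `IsAnchorAtom r rsh`).

No theorem, no instance, no notation; 0 sorry.
-/


open scoped BigOperators Classical InnerProductSpace RealInnerProductSpace
open MeasureTheory Set Metric Filter Topology
open Summit.AtomisticToContinuum.Crystallization.Theorems.ChartedPlanarOrderRigidityDoor (E3 IsClean)
open Summit.AtomisticToContinuum.Crystallization.Theorems.ChartedPlanarOrderDensityDichotomy (μS IsSep)
open Summit.AtomisticToContinuum.Crystallization.Theorems.ChartedPlanarOrderCleanScaleP (IsCleanP IsDoorSetP isCleanP_one_iff isCleanP_mono)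
open Summit.AtomisticToContinuum.Crystallization.Theorems.ChartedPlanarOrderMesoCut (LayeredHom EnvClose)
open Summit.AtomisticToContinuum.Crystallization.Theorems.ChartedPlanarOrderDoorLayeredOsc (IsTwoShellAffineGood)
open Literature.MathematicalPhysics.StatisticalMechanics (lennardJones)

namespace Summit.AtomisticToContinuum.Crystallization.Theorems.ChartedZeroExcessLayeredLatticeLiouville

section W1Pieces

/-- (SV₂): the variant label's clause (iv) read from `rΘ`; inputs at `r`. -/
def SingleVariantP₂ (ϑc ϑp r rΘ q rsh rm σ ϑr Rs ε rI ℓ τ aHi Λ θ s : ℝ) : Prop :=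
  ∀ δ : ℝ, 0 < δ → ∀ a : ℝ, 0 < a →
    ∀ S : Set E3, IsDoorSetP aHi δ S → (∀ z : E3, Summable fun y : S => lennardJones (dist z (y : E3))) →
      (∀ p ∈ S, IsTwoShellAffineGood θ S p) →
        ∀ (L : E3 ≃L[ℝ] E3) (w : ℤ → E3), IsEquilChart a s Λ L w →
          ∀ (x₀ : E3) (K : Set E3), K ⊆ S → (∀ k ∈ K, dist k x₀ ≤ q) →
            IsTameOn ϑp S (LayeredHom (L : E3 →L[ℝ] E3) w) (coreOf S K rm) →
              IsTameOn ϑc S (LayeredHom (L : E3 →L[ℝ] E3) w) (moatIn S K r (r + rsh)) →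
                ∀ (L' : E3 →L[ℝ] E3) (w' : ℤ → E3) (U : E3 ≃ₗᵢ[ℝ] E3) (t : E3),
                  IsCoolShadowCrystal σ ϑr Rs ε r rI ℓ S K (LayeredHom (L : E3 →L[ℝ] E3) w) L' w' U t →
                    ∃ lab : E3 → E3, IsVariantLabel ϑp τ ε rΘ rm ℓ S K (placedCrystal L' w' U t) lab

/-- (AR₂): anchors re-centred on the moat `(rΘ, r + rsh)` (inside the `ϑc`-tame cool moat), label clause (iv) from `rΘ`. -/
def AnchorRegistrationP₂ (ϑc ϑp r rΘ q rsh rm σ ϑr Rs ε rI ℓ τ ε₁ aHi Λ θ s : ℝ) : Prop :=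
  ∀ δ : ℝ, 0 < δ → ∀ a : ℝ, 0 < a →
    ∀ S : Set E3, IsDoorSetP aHi δ S → (∀ z : E3, Summable fun y : S => lennardJones (dist z (y : E3))) →
      (∀ p ∈ S, IsTwoShellAffineGood θ S p) →
        ∀ (L : E3 ≃L[ℝ] E3) (w : ℤ → E3), IsEquilChart a s Λ L w →
          ∀ (x₀ : E3) (K : Set E3), K ⊆ S → (∀ k ∈ K, dist k x₀ ≤ q) →
            IsTameOn ϑp S (LayeredHom (L : E3 →L[ℝ] E3) w) (coreOf S K rm) →
              IsTameOn ϑc S (LayeredHom (L : E3 →L[ℝ] E3) w) (moatIn S K r (r + rsh)) →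
                ∀ (L' : E3 →L[ℝ] E3) (w' : ℤ → E3) (U : E3 ≃ₗᵢ[ℝ] E3) (t : E3),
                  IsCoolShadowCrystal σ ϑr Rs ε r rI ℓ S K (LayeredHom (L : E3 →L[ℝ] E3) w) L' w' U t →
                    ∀ lab : E3 → E3, IsVariantLabel ϑp τ ε rΘ rm ℓ S K (placedCrystal L' w' U t) lab →
                      ∀ p : E3, IsAnchorAtom rΘ (r + rsh - rΘ) ℓ S K p → dist p (lab p) ≤ ε₁

/-- (LN₂): labelled net for every atom of the ENLARGED core `coreOf S K rΘ`, anchors on the moat `(rΘ, r + rsh)`, label from `rΘ`. -/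
def LabelledNetP₂ (ϑc ϑp r rΘ q rsh rm σ ϑr Rs ε rI ℓ τ ζ κ κ₂ Dm aHi Λ θ s : ℝ) : Prop :=
  ∀ δ : ℝ, 0 < δ → ∀ a : ℝ, 0 < a →
    ∀ S : Set E3, IsDoorSetP aHi δ S → (∀ z : E3, Summable fun y : S => lennardJones (dist z (y : E3))) →
      (∀ p ∈ S, IsTwoShellAffineGood θ S p) →
        ∀ (L : E3 ≃L[ℝ] E3) (w : ℤ → E3), IsEquilChart a s Λ L w →
          ∀ (x₀ : E3) (K : Set E3), K ⊆ S → (∀ k ∈ K, dist k x₀ ≤ q) →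
            IsTameOn ϑp S (LayeredHom (L : E3 →L[ℝ] E3) w) (coreOf S K rm) →
              IsTameOn ϑc S (LayeredHom (L : E3 →L[ℝ] E3) w) (moatIn S K r (r + rsh)) →
                ∀ (L' : E3 →L[ℝ] E3) (w' : ℤ → E3) (U : E3 ≃ₗᵢ[ℝ] E3) (t : E3),
                  IsCoolShadowCrystal σ ϑr Rs ε r rI ℓ S K (LayeredHom (L : E3 →L[ℝ] E3) w) L' w' U t →
                    ∀ lab : E3 → E3, IsVariantLabel ϑp τ ε rΘ rm ℓ S K (placedCrystal L' w' U t) lab →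
                      ∀ x ∈ coreOf S K rΘ, ∀ u : E3, ‖u‖ = 1 →
                        (∃ x₃ : E3, IsAnchorAtom rΘ (r + rsh - rΘ) ℓ S K x₃ ∧ κ * ‖lab x₃ - lab x‖ ≤ ⟪lab x₃ - lab x, u⟫_ℝ ∧
                            IsLabChain (3 * (ϑp + τ)) ζ rm S K lab x x₃) ∨
                        ((∃ p : E3, IsAnchorAtom rΘ (r + rsh - rΘ) ℓ S K p ∧ κ * ‖lab p - lab x‖ ≤ ⟪lab p - lab x, -u⟫_ℝ ∧
                            Dm ≤ dist (lab x) (lab p) ∧ |dist x p - dist (lab x) (lab p)| ≤ 2 * ϑp + τ) ∧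
                          ∃ x₃ : E3, IsAnchorAtom rΘ (r + rsh - rΘ) ℓ S K x₃ ∧ κ₂ * ‖lab x₃ - lab x‖ ≤ ⟪lab x₃ - lab x, u⟫_ℝ ∧
                            IsLabChain (3 * (ϑp + τ)) ζ rm S K lab x x₃)

/-- (CV₂): every deep site is some atom's label, for labels read from `rΘ`. -/
def LabelCoveringP₂ (ϑc ϑp r rΘ q rsh rm σ ϑr Rs ε rI ℓ τ aHi Λ θ s : ℝ) : Prop :=
  ∀ δ : ℝ, 0 < δ → ∀ a : ℝ, 0 < a →
    ∀ S : Set E3, IsDoorSetP aHi δ S → (∀ z : E3, Summable fun y : S => lennardJones (dist z (y : E3))) →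
      (∀ p ∈ S, IsTwoShellAffineGood θ S p) →
        ∀ (L : E3 ≃L[ℝ] E3) (w : ℤ → E3), IsEquilChart a s Λ L w →
          ∀ (x₀ : E3) (K : Set E3), K ⊆ S → (∀ k ∈ K, dist k x₀ ≤ q) →
            IsTameOn ϑp S (LayeredHom (L : E3 →L[ℝ] E3) w) (coreOf S K rm) →
              IsTameOn ϑc S (LayeredHom (L : E3 →L[ℝ] E3) w) (moatIn S K r (r + rsh)) →
                ∀ (L' : E3 →L[ℝ] E3) (w' : ℤ → E3) (U : E3 ≃ₗᵢ[ℝ] E3) (t : E3),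
                  IsCoolShadowCrystal σ ϑr Rs ε r rI ℓ S K (LayeredHom (L : E3 →L[ℝ] E3) w) L' w' U t →
                    ∀ lab : E3 → E3, IsVariantLabel ϑp τ ε rΘ rm ℓ S K (placedCrystal L' w' U t) lab →
                      ∀ c ∈ placedCrystal L' w' U t, (∃ k ∈ K, dist c k ≤ rI) → ∃ p ∈ coreOf S K rm, lab p = c

/-- (GL₂): a bond label whose collar clause (iv) is read from `rΘ`; inputs at `r`. -/
def BondLabelP₂ (ϑc ϑp r rΘ q rsh rm σ ϑr Rs ε rI ℓ aHi Λ θ s : ℝ) : Prop :=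
  ∀ δ : ℝ, 0 < δ → ∀ a : ℝ, 0 < a →
    ∀ S : Set E3, IsDoorSetP aHi δ S → (∀ z : E3, Summable fun y : S => lennardJones (dist z (y : E3))) →
      (∀ p ∈ S, IsTwoShellAffineGood θ S p) →
        ∀ (L : E3 ≃L[ℝ] E3) (w : ℤ → E3), IsEquilChart a s Λ L w →
          ∀ (x₀ : E3) (K : Set E3), K ⊆ S → (∀ k ∈ K, dist k x₀ ≤ q) →
            IsTameOn ϑp S (LayeredHom (L : E3 →L[ℝ] E3) w) (coreOf S K rm) →
              IsTameOn ϑc S (LayeredHom (L : E3 →L[ℝ] E3) w) (moatIn S K r (r + rsh)) →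
                ∀ (L' : E3 →L[ℝ] E3) (w' : ℤ → E3) (U : E3 ≃ₗᵢ[ℝ] E3) (t : E3),
                  IsCoolShadowCrystal σ ϑr Rs ε r rI ℓ S K (LayeredHom (L : E3 →L[ℝ] E3) w) L' w' U t →
                    ∃ lab : E3 → E3, IsBondLabel ε rΘ ℓ S K (placedCrystal L' w' U t) lab

/-- (GC₂): coherence on tame stars of every bond label read from `rΘ` (a WEAKER hypothesis on `lab` than (GC)'s; the mechanism — local graph
rigidity of a 4-star's contact graph inside a Barlow crystal — does not read clause (iv) at all). -/
def BondCoherenceP₂ (ϑc ϑp r rΘ q rsh rm σ ϑr Rs ε rI ℓ τ aHi Λ θ s : ℝ) : Prop :=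
  ∀ δ : ℝ, 0 < δ → ∀ a : ℝ, 0 < a →
    ∀ S : Set E3, IsDoorSetP aHi δ S → (∀ z : E3, Summable fun y : S => lennardJones (dist z (y : E3))) →
      (∀ p ∈ S, IsTwoShellAffineGood θ S p) →
        ∀ (L : E3 ≃L[ℝ] E3) (w : ℤ → E3), IsEquilChart a s Λ L w →
          ∀ (x₀ : E3) (K : Set E3), K ⊆ S → (∀ k ∈ K, dist k x₀ ≤ q) →
            IsTameOn ϑp S (LayeredHom (L : E3 →L[ℝ] E3) w) (coreOf S K rm) →
              IsTameOn ϑc S (LayeredHom (L : E3 →L[ℝ] E3) w) (moatIn S K r (r + rsh)) →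
                ∀ (L' : E3 →L[ℝ] E3) (w' : ℤ → E3) (U : E3 ≃ₗᵢ[ℝ] E3) (t : E3),
                  IsCoolShadowCrystal σ ϑr Rs ε r rI ℓ S K (LayeredHom (L : E3 →L[ℝ] E3) w) L' w' U t →
                    ∀ lab : E3 → E3, IsBondLabel ε rΘ ℓ S K (placedCrystal L' w' U t) lab →
                      (∀ x ∈ coreOf S K rm, ∀ p ∈ S, dist p x ≤ 4 → |dist x p - dist (lab x) (lab p)| ≤ ϑp + τ) ∧
                        ∀ y ∈ coreOf S K rm, ∀ x ∈ S, ∀ p ∈ S, dist x y ≤ 4 → dist p y ≤ 4 →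
                          |dist x p - dist (lab x) (lab p)| ≤ 2 * ϑp + τ

end W1Pieces

end Summit.AtomisticToContinuum.Crystallization.Theorems.ChartedZeroExcessLayeredLatticeLiouville
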